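import Summits.QuantumFields.YangMills.Theorems.IR.EsPolymerPeierlsTailK

/-!
# Crux `IR` (item stmt-QuantumFields-19354) — line «es-polymer-decoupling», reshaped engine, input (c4): THE PEIERLS TAIL OF A
LONG POLYMER NEAR A BLOCK

Helper module for item `stmt-QuantumFields-19354` (`--supports … --as helper`; it closes nothing; lead prover
ym-ir-line-mxc-p1 g2).  Companion of `Theorems/IR/EsPolymerPeierlsTailK.lean` for the short/long splitting of the
two-region mixing argument: for abstract representation data with clause (P) (`0 ≤ act ≤ p^#`) and
`(13⁴+1)² √p ≤ 1/2`, the gas-probability that SOME polymer near the radius-`k` block about `c` has MORE THAN `m` cells is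
at most `2 (2k+3)⁴ (√p)^{m+2}` (`sum_mass_exists_long_le_pow`); a generic union bound over the polymers present
(`sum_mass_filter_le_of_exists_mem`).  Short polymers (`≤ m` cells) near the block stay within cell distance
`k + 1 + 6(m−1)` of its centre (`cellDist_le_of_mem_nearFamily_of_card_le`).

HONEST FRAMING: bookkeeping for an OPEN engine stub of a CONDITIONAL rung line; nothing about Yang–Mills is proved here. -/

set_option autoImplicit false

noncomputable section

open MeasureTheory Finset Function
open Literature.MathematicalPhysics.QuantumFieldTheory
open Literature.Probability.LatticeModels (IsRConnected sum_pow_card_le_of_connected)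

namespace Summit.QuantumFields.YangMills.Cruxes.IR.EsPolymer

/-- A polymer with at most `m` cells, one of them within `k+1` of `c`, lies within cell distance `k + 1 + 6 (m − 1)` of
`c`. -/
theorem cellDist_le_of_mem_nearFamily_of_card_le {q k m : ℕ} {Γ : Finset (Finset (Cell q))} (hΓ : Compatible Γ)
    {c : Cell q} {γ : Finset (Cell q)} (hγ : γ ∈ nearFamily Γ c k) (hm : γ.card ≤ m) {x : Cell q} (hx : x ∈ γ) :
    cellDist c x ≤ k + 1 + 6 * (m - 1) := by
  obtain ⟨hγΓ, c', hc', hd⟩ := mem_nearFamily.1 hγ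
  have hdiam := cellDist_le_mul_card_sub_one (hΓ.1 γ hγΓ).2 hc' hx
  have ht := cellDist_triangle c c' x
  have : 6 * (γ.card - 1) ≤ 6 * (m - 1) := Nat.mul_le_mul_left _ (by omega)
  omega

section Tail

variable {G : Type} [MeasurableSpace G] {N q : ℕ}
  (ν : Finset (Finset (Cell q)) → Measure (GaugeConfig 4 N G)) (μ : Measure (GaugeConfig 4 N G))
  [IsProbabilityMeasure μ] (hsum : Finset.univ.sum ν = μ) (hν0 : ∀ Γ, ¬ Compatible Γ → ν Γ = 0)

include hsum hν0

omit [IsProbabilityMeasure μ] hsum hν0 in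
/-- **Union bound over the polymers present**: if every family in the event contains a member of `D`, the event's
gas-probability is at most `∑_{γ ∈ D} P(γ ∈ Γ)`. -/
theorem sum_mass_filter_le_of_exists_mem (Bad : Finset (Finset (Cell q)) → Prop) [DecidablePred Bad]
    (D : Finset (Finset (Cell q))) (hBad : ∀ Γ, Bad Γ → ∃ γ ∈ D, γ ∈ Γ) :
    ∑ Γ ∈ Finset.univ.filter (fun Γ => Bad Γ), (ν Γ Set.univ).toReal ≤
      ∑ γ ∈ D, ∑ Γ ∈ Finset.univ.filter (fun Γ => γ ∈ Γ), (ν Γ Set.univ).toReal := by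
  have hR : ∑ γ ∈ D, ∑ Γ ∈ Finset.univ.filter (fun Γ => γ ∈ Γ), (ν Γ Set.univ).toReal =
      ∑ Γ : Finset (Finset (Cell q)), ∑ γ ∈ D, if γ ∈ Γ then (ν Γ Set.univ).toReal else 0 := by
    simp_rw [sum_filter]
    rw [sum_comm]
  rw [sum_filter, hR]
  refine sum_le_sum fun Γ _ => ?_
  have h0 : ∀ γ ∈ D, 0 ≤ (if γ ∈ Γ then (ν Γ Set.univ).toReal else 0) := fun γ _ => by
    split_ifs
    · exact ENNReal.toReal_nonneg
    · exact le_rfl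
  split_ifs with hbad
  · obtain ⟨γ, hγD, hγΓ⟩ := hBad Γ hbad
    calc (ν Γ Set.univ).toReal = if γ ∈ Γ then (ν Γ Set.univ).toReal else 0 := by rw [if_pos hγΓ]
      _ ≤ ∑ γ' ∈ D, if γ' ∈ Γ then (ν Γ Set.univ).toReal else 0 :=
          single_le_sum (f := fun γ' => if γ' ∈ Γ then (ν Γ Set.univ).toReal else 0) h0 hγD
  · exact sum_nonneg h0

open Classical in
/-- **The Peierls tail of a long polymer near a block.**  With clause (P) (`0 ≤ act γ ≤ p^{#γ}`,
`ν_Γ(1) = Z⁻¹ ∏ act` on compatible families) and `(13⁴+1)² √p ≤ 1/2`: the gas-probability that some polymer of the near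
family of the radius-`k` block about `c` has more than `m` cells is at most `2 (2k+3)⁴ (√p)^{m+2}`. -/
theorem sum_mass_exists_long_le_pow [NeZero q] (act : Finset (Cell q) → ℝ) (hact : ∀ γ, 0 ≤ act γ) {Z p : ℝ}
    (hmass : ∀ Γ, Compatible Γ → (ν Γ Set.univ).toReal = Z⁻¹ * ∏ γ ∈ Γ, act γ) (hp : 0 ≤ p)
    (hactp : ∀ γ, act γ ≤ p ^ γ.card) (hsmall : ((13 : ℝ) ^ 4 + 1) ^ 2 * Real.sqrt p ≤ 1 / 2) (k m : ℕ) (c : Cell q) :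
    ∑ Γ ∈ Finset.univ.filter (fun Γ => Compatible Γ ∧ ∃ γ ∈ nearFamily Γ c k, m + 1 ≤ γ.card),
        (ν Γ Set.univ).toReal ≤
      2 * ((2 * k + 3 : ℕ) : ℝ) ^ 4 * Real.sqrt p ^ (m + 2) := by
  set t : ℝ := Real.sqrt p with ht
  have ht0 : 0 ≤ t := Real.sqrt_nonneg p
  have ht1 : t ≤ 1 := by nlinarith [hsmall, ht0]
  have htp : t ^ 2 = p := Real.sq_sqrt hp
  -- the long near polymers
  set D : Finset (Finset (Cell q)) := Finset.univ.filter fun γ : Finset (Cell q) =>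
    (∃ c' ∈ γ, cellDist c c' ≤ k + 1) ∧ m + 1 ≤ γ.card with hD
  set D' : Finset (Finset (Cell q)) := D.filter fun γ => IsPolymer γ with hD'
  -- step 1: union bound + Peierls, non-polymers dropped
  have h1 : ∑ Γ ∈ Finset.univ.filter (fun Γ => Compatible Γ ∧ ∃ γ ∈ nearFamily Γ c k, m + 1 ≤ γ.card),
      (ν Γ Set.univ).toReal ≤ ∑ γ ∈ D', p ^ γ.card := by
    refine (sum_mass_filter_le_of_exists_mem ν
      (fun Γ => Compatible Γ ∧ ∃ γ ∈ nearFamily Γ c k, m + 1 ≤ γ.card) D fun Γ hΓ => ?_).trans ?_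
    · obtain ⟨-, γ, hγ, hγm⟩ := hΓ
      obtain ⟨hγΓ, hnear⟩ := mem_nearFamily.1 hγ
      exact ⟨γ, mem_filter.2 ⟨mem_univ _, hnear, hγm⟩, hγΓ⟩
    rw [← sum_filter_add_sum_filter_not D fun γ => IsPolymer γ]
    have hz : ∑ γ ∈ D.filter (fun γ => ¬ IsPolymer γ), ∑ Γ ∈ Finset.univ.filter (fun Γ => γ ∈ Γ),
        (ν Γ Set.univ).toReal = 0 :=
      sum_eq_zero fun γ hγ => sum_mass_filter_mem_eq_zero_of_not_isPolymer ν hν0 (mem_filter.1 hγ).2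
    rw [hz, add_zero]
    exact sum_le_sum fun γ _ => (sum_mass_filter_mem_le_act ν μ hsum hν0 act hact hmass γ).trans (hactp γ)
  -- step 2: `p^{#γ} ≤ t^{m+1} t^{#γ}` for a long polymer
  have h2 : ∀ γ ∈ D', p ^ γ.card ≤ t ^ (m + 1) * t ^ γ.card := by
    intro γ hγ
    obtain ⟨-, -, hγm⟩ := mem_filter.1 (mem_filter.1 hγ).1
    rw [← htp, ← pow_mul, ← pow_add]
    exact pow_le_pow_of_le_one ht0 ht1 (by omega)
  -- step 3: animal bound at the ball of radius `k+1` about `c`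
  set ball : Finset (Cell q) := Finset.univ.filter fun c' : Cell q => cellDist c c' ≤ k + 1 with hball
  have h3 : ∑ γ ∈ D', t ^ γ.card ≤ ∑ c₁ ∈ ball, ∑ γ ∈ D'.filter (fun γ => c₁ ∈ γ), t ^ γ.card := by
    have hR : ∑ c₁ ∈ ball, ∑ γ ∈ D'.filter (fun γ => c₁ ∈ γ), t ^ γ.card =
        ∑ γ ∈ D', ∑ c₁ ∈ ball, if c₁ ∈ γ then t ^ γ.card else 0 := by
      simp_rw [sum_filter]; rw [sum_comm]
    rw [hR]
    refine sum_le_sum fun γ hγ => ?_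
    obtain ⟨-, ⟨c₁, h₁, h₁d⟩, -⟩ := mem_filter.1 (mem_filter.1 hγ).1
    have hc₁ : c₁ ∈ ball := mem_filter.2 ⟨mem_univ _, h₁d⟩
    have h0 : ∀ c ∈ ball, 0 ≤ (if c ∈ γ then t ^ γ.card else 0) := fun c _ => by
      split_ifs
      · exact pow_nonneg ht0 _
      · exact le_rfl
    calc t ^ γ.card = if c₁ ∈ γ then t ^ γ.card else 0 := by rw [if_pos h₁]
      _ ≤ _ := single_le_sum (f := fun c => if c ∈ γ then t ^ γ.card else 0) h0 hc₁
  have h4 : ∀ c₁ : Cell q, ∑ γ ∈ D'.filter (fun γ => c₁ ∈ γ), t ^ γ.card ≤ 2 * t := by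
    intro c₁
    refine sum_pow_card_le_of_connected (R := fun x y : Cell q => cellDist x y ≤ 6)
      (nbr := fun x => Finset.univ.filter fun y : Cell q => cellDist x y ≤ 6) (Δ := 13 ^ 4)
      (fun x y h => by rwa [cellDist_comm]) (fun x => ?_) (fun x y h => mem_filter.2 ⟨mem_univ _, h⟩) ht0 ?_ c₁ _
      fun γ hγ => ?_
    · exact (card_filter_cellDist_le x 6).trans (by norm_num)
    · push_cast; linarith [hsmall]
    · obtain ⟨hγD', hc₁⟩ := mem_filter.1 hγ
      have hP : IsPolymer γ := (mem_filter.1 hγD').2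
      exact ⟨hc₁, hP.1, fun c hc c' hc' => Relation.ReflTransGen.mono
        (fun x y (h : x ∈ γ ∧ y ∈ γ ∧ cellDist x y ≤ 6) => (⟨h.2.2, h.1, h.2.1⟩ : cellDist x y ≤ 6 ∧ x ∈ γ ∧ y ∈ γ))
        _ _ (hP.2 c hc c' hc')⟩
  have hballcard : (ball.card : ℝ) ≤ ((2 * k + 3 : ℕ) : ℝ) ^ 4 := by
    have := card_filter_cellDist_le c (k + 1)
    have h' : 2 * (k + 1) + 1 = 2 * k + 3 := by ring
    rw [h'] at this
    exact_mod_cast this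
  calc ∑ Γ ∈ Finset.univ.filter (fun Γ => Compatible Γ ∧ ∃ γ ∈ nearFamily Γ c k, m + 1 ≤ γ.card),
        (ν Γ Set.univ).toReal
      ≤ ∑ γ ∈ D', p ^ γ.card := h1
    _ ≤ ∑ γ ∈ D', t ^ (m + 1) * t ^ γ.card := sum_le_sum h2
    _ = t ^ (m + 1) * ∑ γ ∈ D', t ^ γ.card := by rw [mul_sum]
    _ ≤ t ^ (m + 1) * ∑ c₁ ∈ ball, ∑ γ ∈ D'.filter (fun γ => c₁ ∈ γ), t ^ γ.card :=
        mul_le_mul_of_nonneg_left h3 (pow_nonneg ht0 _)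
    _ ≤ t ^ (m + 1) * ∑ _c₁ ∈ ball, 2 * t := mul_le_mul_of_nonneg_left (sum_le_sum fun c₁ _ => h4 c₁) (pow_nonneg ht0 _)
    _ = t ^ (m + 1) * (ball.card * (2 * t)) := by rw [sum_const, nsmul_eq_mul]
    _ ≤ t ^ (m + 1) * (((2 * k + 3 : ℕ) : ℝ) ^ 4 * (2 * t)) :=
        mul_le_mul_of_nonneg_left (mul_le_mul_of_nonneg_right hballcard (by positivity)) (pow_nonneg ht0 _)
    _ = 2 * ((2 * k + 3 : ℕ) : ℝ) ^ 4 * t ^ (m + 2) := by ring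

end Tail

end Summit.QuantumFields.YangMills.Cruxes.IR.EsPolymer

end
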